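import Summits.AtomisticToContinuum.Crystallization.Theorems.FrustratedLawDichotomyStrainedPatchHomSlopeLJAffine2KitS
import Summits.AtomisticToContinuum.Crystallization.Theorems.FrustratedLawDichotomyStrainedPatchHomSlopeLJAffine2QKit

/-!
# The SHARP per-label third-order slope estimate of the pure Lennard-Jones profile (radially split constant) and the sum bound `rem3LJS_sum_le`
# (27623 `(H) HomFloor (1/625)`, hcp half; the «sharp per-label rem3» lever, critic rows 1368 (2) / 1408 (4); sequel of `…HomSlopeLJAffine2KitS`)

decomp-a2c hand-1 g37 (crux `AperiodicFrustratedLawGap`, stmt-AtomisticToContinuum-27623).  With the kernel arrays of `…HomSlopeLJAffine2KitS`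
(`pdA`, `ndA`, `nd2A`, `radA`, `kSl3Snum`, `rem3Sb`, `rem3LJS`) and the real sharp expansion `…HomSlopePathThirdSharp.slopeForm_thirdOrder_sharp`:

* ★★★ `label_slope3S_LJ` — the per-label third-order estimate with the SHARP constant `(K₃♯A³ + 3K₂♯(A N² + A² N) + 6K₁♯ N³)/6`
  (`K₃♯ = |α″ρ²|↑ + 2|α′ρ|↑`, `K₂♯ = |α′ρ|↑ + |α|↑`, `K₁♯ = |α|↑` on the tube; `A = radA P N N2 tlo`), the closed-form first/second-order terms VERBATIM
  those of `…HomSlopeLJThird.label_slope3_LJ` (so the consumer twin of `…Affine2Q.slopeLJA2Q_bound_of_check` changes only its remainder step);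
* ★ `label_slope3S_LJ_of_ok` (from `ljLabelOK`), ★ `rem3LJS_sum_le`;
* ★ `slopeCheckLJA2QS` — `…Affine2QKit.slopeCheckLJA2Q` with `rem3LJS c w J Lc` in place of `rem3LJ c (hullW J w) Lc` (the Boolean the kernel
  facts of a cell decide; soundness = the `…Affine2Q` twin, next file).

ONE computable definition (`slopeCheckLJA2QS`); 0 sorry; standard axioms; no instances / notation / `#eval`.  `--supports stmt-AtomisticToContinuum-27623`.
-/

noncomputable section

namespace Summit.AtomisticToContinuum.Crystallization.Theorems.FrustratedLawDichotomyStrainedPatchHomSlopeLJThirdSharp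

open scoped BigOperators RealInnerProductSpace
open Literature.Analysis.ValidatedNumerics.Numerics
open Summit.AtomisticToContinuum.Crystallization.Theorems.ChargedEnergyGapNegative (E3)
open Summit.AtomisticToContinuum.Crystallization.Theorems.FrustratedLawDichotomyStrainedPatchHomSplit (latPt hexFrame hcpShift)
open Summit.AtomisticToContinuum.Crystallization.Theorems.FrustratedLawDichotomyStrainedPatchHomEntryGramHcp (dot3 mem_dot3)
open Summit.AtomisticToContinuum.Crystallization.Theorems.FrustratedLawDichotomyStrainedPatchHomForceKit (phiFI)
open Summit.AtomisticToContinuum.Crystallization.Theorems.FrustratedLawDichotomyStrainedPatchHomConvexCurvature (inner_eq_sum3 norm_sq_eq_sum)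
open Summit.AtomisticToContinuum.Crystallization.Theorems.FrustratedLawDichotomyStrainedPatchHomCurvCentre (norm_sq_le_of_abs_le)
open Summit.AtomisticToContinuum.Crystallization.Theorems.FrustratedLawDichotomyStrainedPatchHomCurvCentreKit
open Summit.AtomisticToContinuum.Crystallization.Theorems.FrustratedLawDichotomyStrainedPatchHomCurvRegime3
open Summit.AtomisticToContinuum.Crystallization.Theorems.FrustratedLawDichotomyStrainedPatchHomCurvLeafL (dflt3)
open Summit.AtomisticToContinuum.Crystallization.Theorems.FrustratedLawDichotomyStrainedPatchHomCurvCoeff3 (ljTripleFI mem_ljTripleFI)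
open Summit.AtomisticToContinuum.Crystallization.Theorems.FrustratedLawDichotomyStrainedPatchHomCurvLJ
  (A0lj B0lj A1qlj a1qLJ ttLJ t0LJ Q0 ljLabelOK naiveLJ betaLJ_of_mem_phiFI)
open Summit.AtomisticToContinuum.Crystallization.Theorems.FrustratedLawDichotomyStrainedPatchHomSlopeLJ (g0LJ naiSLJ)
open Summit.AtomisticToContinuum.Crystallization.Theorems.FrustratedLawDichotomyStrainedPatchHomEntryLeafHT (sqrtQ)
open Summit.AtomisticToContinuum.Crystallization.Theorems.FrustratedLawDichotomyStrainedPatchHomSlopeLJAffine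
open Summit.AtomisticToContinuum.Crystallization.Theorems.FrustratedLawDichotomyStrainedPatchHomSlopeLJAffine2Kit (MfiA Mre mem_MfiA mDb quadVec2F)
open Summit.AtomisticToContinuum.Crystallization.Theorems.FrustratedLawDichotomyStrainedPatchTaylorChord (segR segS)
open Summit.AtomisticToContinuum.Crystallization.Theorems.FrustratedLawDichotomyStrainedPatchHomSlopePathThirdSharp
  (slopeForm_thirdOrder_sharp abs_segS_le_min)
open Summit.AtomisticToContinuum.Crystallization.Theorems.FrustratedLawDichotomyStrainedPatchHomSlopeLJAffine2KitS


/-! ## §3. ★★★ The sharp per-label third-order estimate -/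

/-- ★★★ **PER-LABEL THIRD-ORDER SLOPE ESTIMATE, PURE LJ PROFILE, SHARP (radially split) CONSTANT** on any positive tube; the closed-form first- and
second-order terms are those of `…HomSlopeLJThird.label_slope3_LJ` verbatim.  Extra inputs: scaled bounds `P ≥ |⟪p_b,d_b⟫|·SC`, `N ≥ ‖d_b‖·SC`,
`N2 ≥ ‖d_b‖²·SC`. [folklore chaining: `slopeForm_thirdOrder_sharp` with `B = betaLJ`, `B₁ = α·r`, `B₂ = α′r + α`, `B₃ = α″r + 2α′`; `ljTripleFI`] -/
theorem label_slope3S_LJ {c w : (Fin 3 × Fin 3) ⊕ Fin 3 → ℤ} {b : Fin 3 → ℤ} (hlo : 0 < (tube2 c w b).lo)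
    {tt t0 : FI × FI × FI} {B0 a1q : FI}
    (htt : ljTripleFI ((tube2 c w b).mul (tube2 c w b)) = some tt) (ht0 : ljTripleFI (dot3 (cenVec c b) (cenVec c b)) = some t0)
    (hb0 : phiFI (dot3 (cenVec c b) (cenVec c b)) = some B0) (hq : FI.divPos t0.2.1 (dot3 (cenVec c b) (cenVec c b)) = some a1q)
    (U : E3 →L[ℝ] E3)
    (hbox : ∀ ab : Fin 3 × Fin 3, |(U (EuclideanSpace.single ab.2 (1 : ℝ))) ab.1 - (c (Sum.inl ab) : ℝ) / SC| ≤ (w (Sum.inl ab) : ℝ) / SC)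
    (η : E3) (hη : ∀ i : Fin 3, |η i - (c (Sum.inr i) : ℝ) / SC| ≤ (w (Sum.inr i) : ℝ) / SC) (Δ : E3) {P N N2 : ℤ}
    (hP : |⟪cenPt c b, latPt U hexFrame b + U (hcpShift + η) - cenPt c b⟫| * SC ≤ (P : ℝ))
    (hN : ‖latPt U hexFrame b + U (hcpShift + η) - cenPt c b‖ * SC ≤ (N : ℝ))
    (hN2 : ‖latPt U hexFrame b + U (hcpShift + η) - cenPt c b‖ ^ 2 * SC ≤ (N2 : ℝ)) :
    FI.mem (alphaLJ ‖cenPt c b‖) t0.1 ∧ FI.mem (betaLJ ‖cenPt c b‖) B0 ∧ FI.mem (alpha1LJ ‖cenPt c b‖ / ‖cenPt c b‖) a1q ∧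
      |betaLJ ‖latPt U hexFrame b + U (hcpShift + η)‖ * ⟪latPt U hexFrame b + U (hcpShift + η), Δ⟫ - betaLJ ‖cenPt c b‖ * ⟪cenPt c b, Δ⟫ -
          (alphaLJ ‖cenPt c b‖ * ⟪cenPt c b, latPt U hexFrame b + U (hcpShift + η) - cenPt c b⟫ * ⟪cenPt c b, Δ⟫ +
            betaLJ ‖cenPt c b‖ * ⟪latPt U hexFrame b + U (hcpShift + η) - cenPt c b, Δ⟫) -
          ((alpha1LJ ‖cenPt c b‖ / ‖cenPt c b‖ * ⟪cenPt c b, latPt U hexFrame b + U (hcpShift + η) - cenPt c b⟫ ^ 2 +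
              alphaLJ ‖cenPt c b‖ * ‖latPt U hexFrame b + U (hcpShift + η) - cenPt c b‖ ^ 2) * ⟪cenPt c b, Δ⟫ +
            2 * alphaLJ ‖cenPt c b‖ * ⟪cenPt c b, latPt U hexFrame b + U (hcpShift + η) - cenPt c b⟫ *
              ⟪latPt U hexFrame b + U (hcpShift + η) - cenPt c b, Δ⟫) / 2| ≤
        ((kSl3Snum tt (radA P N N2 (tube2 c w b).lo) N N2 : ℤ) : ℝ) / SC / SC / 6 * ‖Δ‖ := by
  have hS : (0 : ℝ) < SC := by norm_num [SC]
  set T := tube2 c w b with hT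
  set p := cenPt c b with hp
  set cb := latPt U hexFrame b + U (hcpShift + η) with hcb
  set d := cb - p with hd
  set aa : ℝ := (T.lo : ℝ) / SC with haa
  set bb : ℝ := (T.hi : ℝ) / SC with hbb
  have ha : 0 < aa := div_pos (by exact_mod_cast hlo) hS
  have hreg' : ∀ r, aa < r → r < bb → r ≠ 0 := fun r h1 _ => (ha.trans h1).ne'
  have htube : ∀ t ∈ Set.Icc (0 : ℝ) 1, aa < segR p d t ∧ segR p d t < bb := fun t ht => by
    have := tube2_mem U hbox η hη b ht
    simpa [segR, hp, hd, hcb] using this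
  -- the three sharp tube constants
  set K3r : ℝ := ((tt.2.2.absHi + 2 * tt.2.1.absHi : ℤ) : ℝ) / SC with hK3r
  set K2r : ℝ := ((tt.2.1.absHi + tt.1.absHi : ℤ) : ℝ) / SC with hK2r
  set K1r : ℝ := ((tt.1.absHi : ℤ) : ℝ) / SC with hK1r
  have hmemT : ∀ r, aa < r → r < bb → FI.mem (alphaLJ r) tt.1 ∧ FI.mem (alpha1LJ r * r) tt.2.1 ∧ FI.mem (alpha2LJ r * r ^ 2) tt.2.2 := by
    intro r h1 h2
    have hmT : FI.mem r T := mem_of_strict h1 h2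
    have hq2 : FI.mem (r ^ 2) (T.mul T) := by rw [sq]; exact FI.mem_mul hmT hmT
    exact mem_ljTripleFI hq2 htt
  have hK₃ : ∀ r, aa < r → r < bb → |alpha2LJ r * r + 2 * alpha1LJ r| * r ≤ K3r := by
    intro r h1 h2
    obtain ⟨_, m1, m2⟩ := hmemT r h1 h2
    have hr : 0 < r := ha.trans h1
    have e : |alpha2LJ r * r + 2 * alpha1LJ r| * r = |alpha2LJ r * r ^ 2 + 2 * (alpha1LJ r * r)| := by
      rw [← abs_of_pos hr, ← abs_mul, abs_of_pos hr]; ring_nf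
    rw [e, hK3r]
    have hb : |alpha1LJ r * r| ≤ (tt.2.1.absHi : ℝ) / SC := by rw [le_div_iff₀ hS]; exact FI.abs_le_absHi m1
    have hc : |alpha2LJ r * r ^ 2| ≤ (tt.2.2.absHi : ℝ) / SC := by rw [le_div_iff₀ hS]; exact FI.abs_le_absHi m2
    have h2a : |2 * (alpha1LJ r * r)| = 2 * |alpha1LJ r * r| := by rw [abs_mul]; norm_num
    calc |alpha2LJ r * r ^ 2 + 2 * (alpha1LJ r * r)| ≤ |alpha2LJ r * r ^ 2| + |2 * (alpha1LJ r * r)| := abs_add_le _ _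
      _ ≤ (tt.2.2.absHi : ℝ) / SC + 2 * ((tt.2.1.absHi : ℝ) / SC) := by rw [h2a]; exact add_le_add hc (by linarith)
      _ = ((tt.2.2.absHi + 2 * tt.2.1.absHi : ℤ) : ℝ) / SC := by push_cast; ring
  have hK₂ : ∀ r, aa < r → r < bb → |alpha1LJ r * r + alphaLJ r| ≤ K2r := by
    intro r h1 h2
    obtain ⟨m0, m1, _⟩ := hmemT r h1 h2
    rw [hK2r]
    have ha' : |alphaLJ r| ≤ (tt.1.absHi : ℝ) / SC := by rw [le_div_iff₀ hS]; exact FI.abs_le_absHi m0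
    have hb : |alpha1LJ r * r| ≤ (tt.2.1.absHi : ℝ) / SC := by rw [le_div_iff₀ hS]; exact FI.abs_le_absHi m1
    calc |alpha1LJ r * r + alphaLJ r| ≤ |alpha1LJ r * r| + |alphaLJ r| := abs_add_le _ _
      _ ≤ (tt.2.1.absHi : ℝ) / SC + (tt.1.absHi : ℝ) / SC := add_le_add hb ha'
      _ = ((tt.2.1.absHi + tt.1.absHi : ℤ) : ℝ) / SC := by push_cast; ring
  have hK₁ : ∀ r, aa < r → r < bb → |alphaLJ r * r| / r ≤ K1r := by
    intro r h1 h2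
    obtain ⟨m0, _, _⟩ := hmemT r h1 h2
    have hr : 0 < r := ha.trans h1
    have e : |alphaLJ r * r| / r = |alphaLJ r| := by rw [abs_mul, abs_of_pos hr]; field_simp
    rw [e, hK1r, le_div_iff₀ hS]
    exact FI.abs_le_absHi m0
  -- the radial bound `A`
  set A : ℤ := radA P N N2 T.lo with hAdef
  set Ar : ℝ := (A : ℝ) / SC with hAr
  have hN2' : ‖d‖ ^ 2 ≤ (N2 : ℝ) / SC := by rw [le_div_iff₀ hS]; exact hN2
  have hN' : ‖d‖ ≤ (N : ℝ) / SC := by rw [le_div_iff₀ hS]; exact hN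
  have hP' : |⟪p, d⟫| ≤ (P : ℝ) / SC := by rw [le_div_iff₀ hS]; exact hP
  have hσA : ∀ t ∈ Set.Icc (0 : ℝ) 1, |segS p d t| ≤ Ar := by
    intro t ht
    have hat : aa ≤ segR p d t := (htube t ht).1.le
    have h := abs_segS_le_min ha hat ht hP'
    refine h.trans ?_
    have hy : ((P : ℝ) / SC + ‖d‖ ^ 2) / aa ≤ ((cdiv ((P + N2) * SC) T.lo : ℤ) : ℝ) / SC := by
      have h1 : (P : ℝ) / SC + ‖d‖ ^ 2 ≤ ((P + N2 : ℤ) : ℝ) / SC := by push_cast; rw [add_div]; linarith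
      have h2 : ((P : ℝ) / SC + ‖d‖ ^ 2) / aa ≤ (((P + N2 : ℤ) : ℝ) / SC) / aa := div_le_div_of_nonneg_right h1 ha.le
      refine h2.trans ?_
      have hcd := div_le_cdiv (a := (P + N2) * SC) (b := T.lo) hlo
      have hlo' : (0 : ℝ) < T.lo := by exact_mod_cast hlo
      have e : (((P + N2 : ℤ) : ℝ) / SC) / aa = (((P + N2) * SC : ℤ) : ℝ) / (T.lo : ℝ) / SC := by
        rw [haa]; push_cast; field_simp
      rw [e]
      exact div_le_div_of_nonneg_right hcd hS.le
    calc min ‖d‖ (((P : ℝ) / SC + ‖d‖ ^ 2) / aa) ≤ min ((N : ℝ) / SC) (((cdiv ((P + N2) * SC) T.lo : ℤ) : ℝ) / SC) := min_le_min hN' hy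
      _ = Ar := by rw [hAr, hAdef, radA, Int.cast_min, min_div_div_right hS.le]
  have hA0 : 0 ≤ Ar := (abs_nonneg _).trans (hσA 0 ⟨le_refl _, zero_le_one⟩)
  have hSF := slopeForm_thirdOrder_sharp (B := betaLJ) (B₁ := fun s => alphaLJ s * s) (B₂ := fun s => alpha1LJ s * s + alphaLJ s)
    (B₃ := fun s => alpha2LJ s * s + 2 * alpha1LJ s) (K₁ := K1r) (K₂ := K2r) (K₃ := K3r) (A := Ar) (p := p) (d := d) (Δ := Δ) ha hA0 htube hσA
    (fun r h1 h2 => hasDerivAt_betaLJ (hreg' r h1 h2))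
    (fun r h1 h2 => hasDerivAt_alphaLJ_mul (hreg' r h1 h2))
    (fun r h1 h2 => by
      have hne := hreg' r h1 h2
      have h := ((hasDerivAt_alpha1LJ hne).mul (hasDerivAt_id' r)).add (hasDerivAt_alphaLJ hne)
      exact h.congr_deriv (by simp; ring))
    hK₃ hK₂ hK₁
  -- centre data
  have h0t := htube 0 (by simp)
  have hR0 : segR p d 0 = ‖p‖ := by simp [segR]
  rw [hR0] at h0t
  have hρpos : 0 < ‖p‖ := ha.trans h0t.1
  have hQ0 := (mem_rho0 c b).1
  obtain ⟨m0c, m1c, _⟩ := mem_ljTripleFI hQ0 ht0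
  have hβ0 : FI.mem (betaLJ ‖p‖) B0 := betaLJ_of_mem_phiFI hQ0 hb0
  have ha1 : FI.mem (alpha1LJ ‖p‖ / ‖p‖) a1q := by
    have := FI.mem_divPos hq m1c hQ0
    have e : alpha1LJ ‖p‖ * ‖p‖ / ‖p‖ ^ 2 = alpha1LJ ‖p‖ / ‖p‖ := by field_simp
    rw [e] at this; exact this
  refine ⟨m0c, hβ0, ha1, ?_⟩
  have hpd : p + d = cb := by rw [hd]; abel
  simp only [hpd] at hSF
  have e1 : alphaLJ ‖p‖ * ‖p‖ * (⟪p, d⟫ / ‖p‖) = alphaLJ ‖p‖ * ⟪p, d⟫ := by field_simp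
  have e2 : ((alpha1LJ ‖p‖ * ‖p‖ + alphaLJ ‖p‖) * (⟪p, d⟫ / ‖p‖) ^ 2 + alphaLJ ‖p‖ * ‖p‖ * ((‖d‖ ^ 2 - (⟪p, d⟫ / ‖p‖) ^ 2) / ‖p‖)) * ⟪p, Δ⟫ +
      2 * (alphaLJ ‖p‖ * ‖p‖) * (⟪p, d⟫ / ‖p‖) * ⟪d, Δ⟫ =
      (alpha1LJ ‖p‖ / ‖p‖ * ⟪p, d⟫ ^ 2 + alphaLJ ‖p‖ * ‖d‖ ^ 2) * ⟪p, Δ⟫ + 2 * alphaLJ ‖p‖ * ⟪p, d⟫ * ⟪d, Δ⟫ := by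
    field_simp
    ring
  rw [e1, e2] at hSF
  -- the scaled numerator dominates the sharp real constant
  have hK10 : 0 ≤ K1r := by
    obtain ⟨m0, _, _⟩ := hmemT ‖p‖ h0t.1 h0t.2
    have := hK₁ ‖p‖ h0t.1 h0t.2
    exact le_trans (div_nonneg (abs_nonneg _) hρpos.le) this
  have hK20 : 0 ≤ K2r := le_trans (abs_nonneg _) (hK₂ ‖p‖ h0t.1 h0t.2)
  have hK30 : 0 ≤ K3r := le_trans (mul_nonneg (abs_nonneg _) hρpos.le) (hK₃ ‖p‖ h0t.1 h0t.2)
  have hd0 : 0 ≤ ‖d‖ := norm_nonneg _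
  have hA2 : Ar ^ 2 ≤ ((cdiv (A * A) SC : ℤ) : ℝ) / SC := by rw [sq]; exact mul_le_cdivS hA0 hA0 le_rfl le_rfl
  have hA3 : Ar ^ 3 ≤ ((cubS A : ℤ) : ℝ) / SC := by
    rw [pow_succ, cubS]; exact mul_le_cdivS (by positivity) hA0 hA2 le_rfl
  have hAN2 : Ar * ‖d‖ ^ 2 ≤ ((cdiv (A * N2) SC : ℤ) : ℝ) / SC := mul_le_cdivS hA0 (by positivity) le_rfl hN2'
  have hA2N : Ar ^ 2 * ‖d‖ ≤ ((cdiv (cdiv (A * A) SC * N) SC : ℤ) : ℝ) / SC := mul_le_cdivS (by positivity) hd0 hA2 hN'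
  have hN3 : ‖d‖ ^ 3 ≤ ((cdiv (N * N2) SC : ℤ) : ℝ) / SC := by
    rw [show ‖d‖ ^ 3 = ‖d‖ * ‖d‖ ^ 2 by ring]; exact mul_le_cdivS hd0 (by positivity) hN' hN2'
  have hnum : K3r * Ar ^ 3 + 3 * K2r * (Ar * ‖d‖ ^ 2 + Ar ^ 2 * ‖d‖) + 6 * K1r * ‖d‖ ^ 3 ≤
      ((kSl3Snum tt A N N2 : ℤ) : ℝ) / SC / SC := by
    have h1 : K3r * Ar ^ 3 ≤ K3r * (((cubS A : ℤ) : ℝ) / SC) := mul_le_mul_of_nonneg_left hA3 hK30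
    have h2 : 3 * K2r * (Ar * ‖d‖ ^ 2 + Ar ^ 2 * ‖d‖) ≤
        3 * K2r * (((cdiv (A * N2) SC : ℤ) : ℝ) / SC + ((cdiv (cdiv (A * A) SC * N) SC : ℤ) : ℝ) / SC) :=
      mul_le_mul_of_nonneg_left (add_le_add hAN2 hA2N) (by positivity)
    have h3 : 6 * K1r * ‖d‖ ^ 3 ≤ 6 * K1r * (((cdiv (N * N2) SC : ℤ) : ℝ) / SC) := mul_le_mul_of_nonneg_left hN3 (by positivity)
    have e : K3r * (((cubS A : ℤ) : ℝ) / SC) +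
        3 * K2r * (((cdiv (A * N2) SC : ℤ) : ℝ) / SC + ((cdiv (cdiv (A * A) SC * N) SC : ℤ) : ℝ) / SC) +
        6 * K1r * (((cdiv (N * N2) SC : ℤ) : ℝ) / SC) = ((kSl3Snum tt A N N2 : ℤ) : ℝ) / SC / SC := by
      rw [hK3r, hK2r, hK1r, kSl3Snum]
      push_cast
      field_simp
    linarith [h1, h2, h3, e.le]
  have hbound : (K3r * Ar ^ 3 + 3 * K2r * (Ar * ‖d‖ ^ 2 + Ar ^ 2 * ‖d‖) + 6 * K1r * ‖d‖ ^ 3) / 6 * ‖Δ‖ ≤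
      ((kSl3Snum tt A N N2 : ℤ) : ℝ) / SC / SC / 6 * ‖Δ‖ :=
    mul_le_mul_of_nonneg_right (div_le_div_of_nonneg_right hnum (by norm_num)) (norm_nonneg _)
  exact hSF.trans hbound

/-- ★ The sharp per-label estimate from `ljLabelOK`. [folklore chaining: `label_slope3S_LJ`] -/
theorem label_slope3S_LJ_of_ok {c w : (Fin 3 × Fin 3) ⊕ Fin 3 → ℤ} {b : Fin 3 → ℤ} (h : ljLabelOK c w b = true) (U : E3 →L[ℝ] E3)
    (hbox : ∀ ab : Fin 3 × Fin 3, |(U (EuclideanSpace.single ab.2 (1 : ℝ))) ab.1 - (c (Sum.inl ab) : ℝ) / SC| ≤ (w (Sum.inl ab) : ℝ) / SC)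
    (η : E3) (hη : ∀ i : Fin 3, |η i - (c (Sum.inr i) : ℝ) / SC| ≤ (w (Sum.inr i) : ℝ) / SC) (Δ : E3) {P N N2 : ℤ}
    (hP : |⟪cenPt c b, latPt U hexFrame b + U (hcpShift + η) - cenPt c b⟫| * SC ≤ (P : ℝ))
    (hN : ‖latPt U hexFrame b + U (hcpShift + η) - cenPt c b‖ * SC ≤ (N : ℝ))
    (hN2 : ‖latPt U hexFrame b + U (hcpShift + η) - cenPt c b‖ ^ 2 * SC ≤ (N2 : ℝ)) :
    FI.mem (alphaLJ ‖cenPt c b‖) (A0lj c b) ∧ FI.mem (betaLJ ‖cenPt c b‖) (B0lj c b) ∧ FI.mem (alpha1LJ ‖cenPt c b‖ / ‖cenPt c b‖) (A1qlj c b) ∧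
      |betaLJ ‖latPt U hexFrame b + U (hcpShift + η)‖ * ⟪latPt U hexFrame b + U (hcpShift + η), Δ⟫ - betaLJ ‖cenPt c b‖ * ⟪cenPt c b, Δ⟫ -
          (alphaLJ ‖cenPt c b‖ * ⟪cenPt c b, latPt U hexFrame b + U (hcpShift + η) - cenPt c b⟫ * ⟪cenPt c b, Δ⟫ +
            betaLJ ‖cenPt c b‖ * ⟪latPt U hexFrame b + U (hcpShift + η) - cenPt c b, Δ⟫) -
          ((alpha1LJ ‖cenPt c b‖ / ‖cenPt c b‖ * ⟪cenPt c b, latPt U hexFrame b + U (hcpShift + η) - cenPt c b⟫ ^ 2 +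
              alphaLJ ‖cenPt c b‖ * ‖latPt U hexFrame b + U (hcpShift + η) - cenPt c b‖ ^ 2) * ⟪cenPt c b, Δ⟫ +
            2 * alphaLJ ‖cenPt c b‖ * ⟪cenPt c b, latPt U hexFrame b + U (hcpShift + η) - cenPt c b⟫ *
              ⟪latPt U hexFrame b + U (hcpShift + η) - cenPt c b, Δ⟫) / 2| ≤
        ((kSl3Snum ((ttLJ c w b).getD dflt3) (radA P N N2 (tube2 c w b).lo) N N2 : ℤ) : ℝ) / SC / SC / 6 * ‖Δ‖ := by
  simp only [ljLabelOK, Bool.and_eq_true, decide_eq_true_eq] at h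
  obtain ⟨⟨⟨⟨hlo, htt⟩, ht0⟩, hb0⟩, hq⟩ := h
  obtain ⟨tt, htt⟩ := Option.isSome_iff_exists.1 htt
  obtain ⟨t0, ht0⟩ := Option.isSome_iff_exists.1 ht0
  obtain ⟨B0, hb0⟩ := Option.isSome_iff_exists.1 hb0
  obtain ⟨a1q, hq⟩ := Option.isSome_iff_exists.1 hq
  have hq' : FI.divPos t0.2.1 (dot3 (cenVec c b) (cenVec c b)) = some a1q := by
    rw [a1qLJ, ht0] at hq; simpa [Q0] using hq
  have eA : A0lj c b = t0.1 := by simp [A0lj, ht0]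
  have eB : B0lj c b = B0 := by simp [B0lj, hb0]
  have e1 : A1qlj c b = a1q := by simp [A1qlj, hq]
  have eK : (ttLJ c w b).getD dflt3 = tt := by simp [htt]
  rw [eA, eB, e1, eK]
  have htt' : ljTripleFI ((tube2 c w b).mul (tube2 c w b)) = some tt := htt
  exact label_slope3S_LJ hlo htt' ht0 hb0 hq' U hbox η hη Δ hP hN hN2

/-- ★ The sharp third-order remainder sum is below `rem3LJS/SC`. [arithmetic] -/
theorem rem3LJS_sum_le (c w : (Fin 3 × Fin 3) ⊕ Fin 3 → ℤ) (J : Fin 3 → Fin 3 × Fin 3 → ℤ) {Lc : List (Fin 3 → ℤ)} (hLc : Lc.Nodup) :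
    ∑ b ∈ Lc.toFinset, ((kSl3Snum ((ttLJ c (hullW J w) b).getD dflt3)
        (radA (pdA c w J b) (ndA c w J b) (nd2A c w J b) (tube2 c (hullW J w) b).lo) (ndA c w J b) (nd2A c w J b) : ℤ) : ℝ) / SC / SC / 6 ≤
      (rem3LJS c w J Lc : ℝ) / SC := by
  classical
  have hS : (0 : ℝ) < SC := by norm_num [SC]
  have hterm : ∀ bb : Fin 3 → ℤ, ((kSl3Snum ((ttLJ c (hullW J w) bb).getD dflt3)
        (radA (pdA c w J bb) (ndA c w J bb) (nd2A c w J bb) (tube2 c (hullW J w) bb).lo) (ndA c w J bb) (nd2A c w J bb) : ℤ) : ℝ) / SC / SC / 6 ≤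
      ((rem3Sb c w J bb : ℤ) : ℝ) / SC := by
    intro bb
    rw [rem3Sb]
    set num := kSl3Snum ((ttLJ c (hullW J w) bb).getD dflt3)
        (radA (pdA c w J bb) (ndA c w J bb) (nd2A c w J bb) (tube2 c (hullW J w) bb).lo) (ndA c w J bb) (nd2A c w J bb) with hnum
    have h := div_le_cdiv (a := num) (b := 6 * (SC : ℤ)) (by norm_num [SC])
    push_cast at h
    have e : (num : ℝ) / SC / SC / 6 = (num : ℝ) / (6 * SC) / SC := by field_simp
    rw [e]
    exact div_le_div_of_nonneg_right h hS.le
  have h1 := Finset.sum_le_sum fun b (_ : b ∈ Lc.toFinset) => hterm b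
  refine h1.trans (le_of_eq ?_)
  rw [← Finset.sum_div]
  congr 1
  rw [List.sum_toFinset _ hLc, rem3LJS, Int.cast_list_sum, List.map_map]
  rfl

/-! ## §4. The kernel Boolean with the sharp remainder -/

/-- ★ **THE COMPONENT-CERTIFIED SECOND-ORDER AFFINE SLOPE CHECK WITH THE SHARP THIRD-ORDER REMAINDER** (`…Affine2QKit.slopeCheckLJA2Q` with `rem3LJS`). -/
def slopeCheckLJA2QS (c w : (Fin 3 × Fin 3) ⊕ Fin 3 → ℤ) (J : Fin 3 → Fin 3 × Fin 3 → ℤ) (Lc Ln : List (Fin 3 → ℤ)) (Q : Fin 3 → ℤ) (Gs : ℤ) : Bool :=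
  (Lc.all fun b => ljLabelOK c (hullW J w) b) && (Ln.all fun b => (naiveLJ c (hullW J w) b).isSome) &&
    (decide (quadVec2F c w J Lc 0 ≤ Q 0) && decide (quadVec2F c w J Lc 1 ≤ Q 1) && decide (quadVec2F c w J Lc 2 ≤ Q 2)) &&
    decide (g0LJ c Lc + linLJA c w J Lc + sqrtQ Q + rem3LJS c w J Lc + naiSLJ c (hullW J w) Ln ≤ Gs)

end Summit.AtomisticToContinuum.Crystallization.Theorems.FrustratedLawDichotomyStrainedPatchHomSlopeLJThirdSharp

end
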